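import Mathlib.LinearAlgebra.Matrix.GeneralLinearGroup.Defs
import Mathlib.LinearAlgebra.Matrix.Trace
import Mathlib.LinearAlgebra.Matrix.Notation
import Mathlib.LinearAlgebra.Matrix.NonsingularInverse
import Mathlib.GroupTheory.Index
import Mathlib.Tactic.LinearCombination
import Mathlib.Tactic.FieldSimp
import HarnessLib

/-!
# Open image, VI: a normal subgroup with an eigenline — scalars or an index-two stabiliser
(proofs file)

Pure group theory and `2 × 2` linear algebra over a field (theorems only).  Let
`r : Γ → GL₂(E)` be a homomorphism with **no invariant line** (for every `w ≠ 0` some `r(γ)`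
moves `E w`), `V ⊴ Γ` a normal subgroup, and `v ≠ 0` a common eigenvector of `r(V)`.  Then
(`OpenImage.scalar_or_index_two_of_eigenline`) either

* every `r(σ)`, `σ ∈ V`, is **scalar**, or
* the stabiliser `H` of the line `E v` is a subgroup of **index `2`** containing `V`, and
  `tr r(τ) = 0` for every `τ ∉ H`.

(Clifford theory in dimension `2`: `r(τ₀) v = w₀ ∉ E v` for some `τ₀`; `V` acts on the basis
`(v, w₀)` by two characters; if they differ, the `V`-eigenlines are exactly `E v, E w₀`, `Γ`
permutes them, and the elements outside the stabiliser swap them, hence are traceless.)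
This is the group-theoretic step of Ribet 1977, Prop. (4.4) / Thm. (4.5) (an `ℓ`-adic
representation attached to a newform which is abelian on an open subgroup comes from a
quadratic character, i.e. the form has complex multiplication), used in the open-image theorem
`momose_isOpen_range_galoisRep`.

## References

* K. A. Ribet, *Galois representations attached to eigenforms with Nebentypus*, LNM 601 (1977),
  §4, Prop. (4.4), Thm. (4.5). [Ribet1977Nebentypus]
* C. W. Curtis, I. Reiner, *Representation theory of finite groups and associative algebras*
  (1962), §49 (Clifford's theorem).
-/

namespace Literature.NumberTheory.EllipticCurves.ModularForms

namespace OpenImage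

open Matrix

variable {E : Type*} [Field E]

/-! ### Two vectors spanning `E²` -/

/-- If `v ≠ 0` and `w ∉ E v` then the matrix with columns `v, w` has nonzero determinant.
[folklore] -/
theorem det_of_cols_ne_zero {v w : Fin 2 → E} (hv : v ≠ 0) (hw : ¬ ∃ c : E, w = c • v) :
    (Matrix.of fun i j ↦ ![v, w] j i).det ≠ 0 := by
  intro hdet
  rw [Matrix.det_fin_two] at hdet
  simp only [Matrix.of_apply, Matrix.cons_val_zero, Matrix.cons_val_one] at hdet
  -- `v 0 * w 1 - w 0 * v 1 = 0`: the columns are proportional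
  apply hw
  by_cases h0 : v 0 ≠ 0
  · refine ⟨w 0 / v 0, ?_⟩
    ext i; fin_cases i
    · simp; field_simp
    · simp; field_simp; linear_combination hdet
  · push Not at h0
    have h1 : v 1 ≠ 0 := by
      intro h1; apply hv; ext i; fin_cases i <;> simp [h0, h1]
    have hw0 : w 0 = 0 := by
      have : w 0 * v 1 = 0 := by linear_combination -hdet + w 1 * h0
      exact (mul_eq_zero.1 this).resolve_right h1
    refine ⟨w 1 / v 1, ?_⟩
    ext i; fin_cases i
    · simp [h0, hw0]
    · simp; field_simp

/-- With `P = (v | w)` invertible: a matrix is determined by its values on `v` and `w` —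
if `M v = a v + b w` and `M w = c v + d w` then `M = P (a c; b d) P⁻¹`. [folklore] -/
theorem eq_conj_of_mulVec_eq {v w : Fin 2 → E} (hP : (Matrix.of fun i j ↦ ![v, w] j i).det ≠ 0)
    {M : Matrix (Fin 2) (Fin 2) E} {a b c d : E} (hMv : M *ᵥ v = a • v + b • w) (hMw : M *ᵥ w = c • v + d • w) :
    M = (Matrix.of fun i j ↦ ![v, w] j i) * !![a, c; b, d] * (Matrix.of fun i j ↦ ![v, w] j i)⁻¹ := by
  set P : Matrix (Fin 2) (Fin 2) E := Matrix.of fun i j ↦ ![v, w] j i with hPdef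
  have hMP : M * P = P * !![a, c; b, d] := by
    have hv' : ∀ i, (M *ᵥ v) i = a * v i + b * w i := fun i ↦ by
      rw [hMv]; simp
    have hw' : ∀ i, (M *ᵥ w) i = c * v i + d * w i := fun i ↦ by
      rw [hMw]; simp
    ext i j
    fin_cases j
    · have h := hv' i
      simp only [Matrix.mulVec, dotProduct, Fin.sum_univ_two] at h
      simp [hPdef, Matrix.mul_apply, Fin.sum_univ_two, h]
      ring
    · have h := hw' i
      simp only [Matrix.mulVec, dotProduct, Fin.sum_univ_two] at h
      simp [hPdef, Matrix.mul_apply, Fin.sum_univ_two, h]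
      ring
  have hPunit : IsUnit P.det := isUnit_iff_ne_zero.2 hP
  calc M = M * P * P⁻¹ := by rw [Matrix.mul_nonsing_inv_cancel_right _ _ hPunit]
    _ = P * !![a, c; b, d] * P⁻¹ := by rw [hMP]

/-- Scalar on a basis, scalar everywhere: `M v = c v`, `M w = c w` imply `M = c · 1`. [folklore] -/
theorem eq_smul_one_of_mulVec_eq {v w : Fin 2 → E} (hP : (Matrix.of fun i j ↦ ![v, w] j i).det ≠ 0)
    {M : Matrix (Fin 2) (Fin 2) E} {c : E} (hMv : M *ᵥ v = c • v) (hMw : M *ᵥ w = c • w) :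
    M = c • (1 : Matrix (Fin 2) (Fin 2) E) := by
  have h := eq_conj_of_mulVec_eq hP (a := c) (b := 0) (c := 0) (d := c) (by rw [hMv, zero_smul, add_zero])
    (by rw [hMw, zero_smul, zero_add])
  have e : (!![c, 0; 0, c] : Matrix (Fin 2) (Fin 2) E) = c • (1 : Matrix (Fin 2) (Fin 2) E) := by
    ext i j; fin_cases i <;> fin_cases j <;> simp
  rw [h, e, Matrix.mul_smul, Matrix.mul_one, Matrix.smul_mul,
    Matrix.mul_nonsing_inv _ (isUnit_iff_ne_zero.2 hP)]

/-- Swapping a basis up to scalars is traceless: `M v ∈ E w`, `M w ∈ E v` imply `tr M = 0`.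
[folklore] -/
theorem trace_eq_zero_of_swap {v w : Fin 2 → E} (hP : (Matrix.of fun i j ↦ ![v, w] j i).det ≠ 0)
    {M : Matrix (Fin 2) (Fin 2) E} {b c : E} (hMv : M *ᵥ v = b • w) (hMw : M *ᵥ w = c • v) : M.trace = 0 := by
  have h := eq_conj_of_mulVec_eq hP (a := 0) (b := b) (c := c) (d := 0) (by rw [hMv, zero_smul, zero_add])
    (by rw [hMw, zero_smul, add_zero])
  rw [h, Matrix.trace_mul_cycle, Matrix.nonsing_inv_mul _ (isUnit_iff_ne_zero.2 hP), Matrix.one_mul,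
    Matrix.trace_fin_two]
  simp

/-! ### Eigenvectors of an element with two distinct eigenvalues -/

/-- If `M v = a v`, `M w = d w` with `a ≠ d` (`v, w` a basis), the eigenvectors of `M` lie on the
two lines `E v`, `E w`. [folklore] -/
theorem mem_lines_of_eigenvector {v w : Fin 2 → E} (hP : (Matrix.of fun i j ↦ ![v, w] j i).det ≠ 0)
    {M : Matrix (Fin 2) (Fin 2) E} {a d : E} (had : a ≠ d) (hMv : M *ᵥ v = a • v) (hMw : M *ᵥ w = d • w)
    {x : Fin 2 → E} {e : E} (hx : M *ᵥ x = e • x) :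
    (∃ c : E, x = c • v) ∨ (∃ c : E, x = c • w) := by
  -- write `x = p v + q w`
  set P : Matrix (Fin 2) (Fin 2) E := Matrix.of fun i j ↦ ![v, w] j i with hPdef
  have hPunit : IsUnit P.det := isUnit_iff_ne_zero.2 hP
  set y : Fin 2 → E := P⁻¹ *ᵥ x with hy
  have hxy : x = y 0 • v + y 1 • w := by
    have h1 : P *ᵥ y = x := by rw [hy, Matrix.mulVec_mulVec, Matrix.mul_nonsing_inv _ hPunit, Matrix.one_mulVec]
    rw [← h1]
    ext i
    simp [hPdef, Matrix.mulVec, dotProduct, Fin.sum_univ_two, mul_comm]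
  have hM : M *ᵥ x = (y 0 * a) • v + (y 1 * d) • w := by
    rw [hxy, Matrix.mulVec_add, Matrix.mulVec_smul, Matrix.mulVec_smul, hMv, hMw, smul_smul, smul_smul]
  rw [hx, hxy, smul_add, smul_smul, smul_smul] at hM
  -- compare coefficients: `(e - a) y₀ = 0`, `(e - d) y₁ = 0`
  have hcoef : (e * y 0 - y 0 * a) • v + (e * y 1 - y 1 * d) • w = 0 := by
    rw [sub_smul, sub_smul]
    have := sub_eq_zero.2 hM
    rw [← this]
    abel
  have hind : ∀ p q : E, p • v + q • w = 0 → p = 0 ∧ q = 0 := by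
    intro p q hpq
    have h1 : P *ᵥ ![p, q] = 0 := by
      rw [← hpq]
      ext i
      simp [hPdef, Matrix.mulVec, dotProduct, Fin.sum_univ_two, mul_comm]
    have h2 : (![p, q] : Fin 2 → E) = 0 := by
      have := congrArg (P⁻¹ *ᵥ ·) h1
      simp only [Matrix.mulVec_mulVec, Matrix.nonsing_inv_mul _ hPunit, Matrix.one_mulVec, Matrix.mulVec_zero] at this
      exact this
    exact ⟨by simpa using congrFun h2 0, by simpa using congrFun h2 1⟩
  obtain ⟨h0, h1⟩ := hind _ _ hcoef
  by_cases hy0 : y 0 = 0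
  · right; exact ⟨y 1, by rw [hxy, hy0, zero_smul, zero_add]⟩
  · left
    have hea : e = a := by
      have : (e - a) * y 0 = 0 := by linear_combination h0
      exact sub_eq_zero.1 ((mul_eq_zero.1 this).resolve_right hy0)
    have hy1 : y 1 = 0 := by
      have : (e - d) * y 1 = 0 := by linear_combination h1
      refine (mul_eq_zero.1 this).resolve_left ?_
      rw [hea]; exact sub_ne_zero.2 had
    exact ⟨y 0, by rw [hxy, hy1, zero_smul, add_zero]⟩

/-! ### The dichotomy -/

/-- **A normal subgroup with a common eigenline acts by scalars, or its eigenline has an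
index-two stabiliser outside of which all traces vanish.**  Let `r : Γ → GL₂(E)` have no
invariant line, `V ⊴ Γ`, and `v ≠ 0` with `r(σ) v ∈ E v` for all `σ ∈ V`.  Then either every
`r(σ)`, `σ ∈ V`, is scalar, or the stabiliser `H = {τ | r(τ) v ∈ E v}` has index `2`, contains
`V`, and `tr r(τ) = 0` for `τ ∉ H` (Clifford theory in dimension `2`).
[cite: Ribet1977Nebentypus, §4, proof of Prop. (4.4)] -/
theorem scalar_or_index_two_of_eigenline {Γ : Type*} [Group Γ] (r : Γ →* GL (Fin 2) E)
    (V : Subgroup Γ) [hVn : V.Normal]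
    (hirr : ∀ w : Fin 2 → E, w ≠ 0 → ∃ γ : Γ, ¬ ∃ c : E, ((r γ : GL (Fin 2) E) : Matrix (Fin 2) (Fin 2) E) *ᵥ w = c • w)
    {v : Fin 2 → E} (hv : v ≠ 0)
    (hV : ∀ σ ∈ V, ∃ c : E, ((r σ : GL (Fin 2) E) : Matrix (Fin 2) (Fin 2) E) *ᵥ v = c • v) :
    (∀ σ ∈ V, ∃ c : E, ((r σ : GL (Fin 2) E) : Matrix (Fin 2) (Fin 2) E) = c • 1) ∨
    (∃ H : Subgroup Γ, V ≤ H ∧ H.index = 2 ∧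
      ∀ τ, τ ∉ H → (((r τ : GL (Fin 2) E) : Matrix (Fin 2) (Fin 2) E)).trace = 0) := by
  -- notation
  have hmul : ∀ α β : Γ, ((r (α * β) : GL (Fin 2) E) : Matrix (Fin 2) (Fin 2) E) =
      ((r α : GL (Fin 2) E) : Matrix (Fin 2) (Fin 2) E) * ((r β : GL (Fin 2) E) : Matrix (Fin 2) (Fin 2) E) := by
    intro α β; rw [map_mul, Units.val_mul]
  have hact : ∀ (α β : Γ) (x : Fin 2 → E), ((r (α * β) : GL (Fin 2) E) : Matrix (Fin 2) (Fin 2) E) *ᵥ x =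
      ((r α : GL (Fin 2) E) : Matrix (Fin 2) (Fin 2) E) *ᵥ (((r β : GL (Fin 2) E) : Matrix (Fin 2) (Fin 2) E) *ᵥ x) := by
    intro α β x; rw [hmul, Matrix.mulVec_mulVec]
  have hinv : ∀ (α : Γ) (x : Fin 2 → E), ((r α⁻¹ : GL (Fin 2) E) : Matrix (Fin 2) (Fin 2) E) *ᵥ
      (((r α : GL (Fin 2) E) : Matrix (Fin 2) (Fin 2) E) *ᵥ x) = x := by
    intro α x; rw [← hact, inv_mul_cancel, map_one, Units.val_one, Matrix.one_mulVec]
  -- `τ₀` moving the line `E v`, and `w₀ = r(τ₀) v`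
  obtain ⟨τ₀, hτ₀⟩ := hirr v hv
  set w₀ : Fin 2 → E := ((r τ₀ : GL (Fin 2) E) : Matrix (Fin 2) (Fin 2) E) *ᵥ v with hw₀
  have hw₀v : ¬ ∃ c : E, w₀ = c • v := fun ⟨c, hc⟩ ↦ hτ₀ ⟨c, hc⟩
  have hP := det_of_cols_ne_zero hv hw₀v
  -- `V` acts on `w₀` by a character too (normality)
  have hVw : ∀ σ ∈ V, ∃ c : E, ((r σ : GL (Fin 2) E) : Matrix (Fin 2) (Fin 2) E) *ᵥ w₀ = c • w₀ := by
    intro σ hσ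
    have hconj : τ₀⁻¹ * σ * τ₀⁻¹⁻¹ ∈ V := hVn.conj_mem σ hσ τ₀⁻¹
    rw [inv_inv] at hconj
    obtain ⟨c, hc⟩ := hV _ hconj
    refine ⟨c, ?_⟩
    calc ((r σ : GL (Fin 2) E) : Matrix (Fin 2) (Fin 2) E) *ᵥ w₀
        = ((r (σ * τ₀) : GL (Fin 2) E) : Matrix (Fin 2) (Fin 2) E) *ᵥ v := by rw [hw₀, ← hact]
      _ = ((r (τ₀ * (τ₀⁻¹ * σ * τ₀)) : GL (Fin 2) E) : Matrix (Fin 2) (Fin 2) E) *ᵥ v := by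
          rw [show σ * τ₀ = τ₀ * (τ₀⁻¹ * σ * τ₀) by group]
      _ = c • w₀ := by rw [hact, hc, Matrix.mulVec_smul, hw₀]
  -- the two characters
  choose χ₁ hχ₁ using hV
  choose χ₂ hχ₂ using hVw
  by_cases hchar : ∀ σ (hσ : σ ∈ V), χ₁ σ hσ = χ₂ σ hσ
  · -- Case 1: `V` acts by scalars
    left
    intro σ hσ
    refine ⟨χ₁ σ hσ, eq_smul_one_of_mulVec_eq hP (hχ₁ σ hσ) ?_⟩
    rw [hchar σ hσ]; exact hχ₂ σ hσ
  · -- Case 2: an element `σ₁ ∈ V` with distinct eigenvalues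
    right
    push Not at hchar
    obtain ⟨σ₁, hσ₁, hne⟩ := hchar
    -- the stabiliser of the line `E v`
    let H : Subgroup Γ :=
      { carrier := {τ | ∃ c : E, ((r τ : GL (Fin 2) E) : Matrix (Fin 2) (Fin 2) E) *ᵥ v = c • v}
        one_mem' := ⟨1, by rw [map_one, Units.val_one, Matrix.one_mulVec, one_smul]⟩
        mul_mem' := by
          rintro α β ⟨a, ha⟩ ⟨b, hb⟩
          exact ⟨b * a, by rw [hmul, ← Matrix.mulVec_mulVec, hb, Matrix.mulVec_smul, ha, smul_smul]⟩
        inv_mem' := by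
          rintro α ⟨a, ha⟩
          have ha0 : a ≠ 0 := by
            rintro rfl
            rw [zero_smul] at ha
            apply hv
            have := congrArg (((r α⁻¹ : GL (Fin 2) E) : Matrix (Fin 2) (Fin 2) E) *ᵥ ·) ha
            simp only [Matrix.mulVec_mulVec, ← hmul, inv_mul_cancel, map_one, Units.val_one, Matrix.one_mulVec,
              Matrix.mulVec_zero] at this
            exact this
          refine ⟨a⁻¹, ?_⟩
          have := congrArg (((r α⁻¹ : GL (Fin 2) E) : Matrix (Fin 2) (Fin 2) E) *ᵥ ·) ha
          simp only [Matrix.mulVec_mulVec, ← hmul, inv_mul_cancel, map_one, Units.val_one, Matrix.one_mulVec,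
            Matrix.mulVec_smul] at this
          rw [eq_inv_smul_iff₀ ha0]
          exact this.symm }
    have hHmem : ∀ {τ}, τ ∈ H ↔ ∃ c : E, ((r τ : GL (Fin 2) E) : Matrix (Fin 2) (Fin 2) E) *ᵥ v = c • v := Iff.rfl
    have hVH : V ≤ H := fun σ hσ ↦ hHmem.2 ⟨χ₁ σ hσ, hχ₁ σ hσ⟩
    have hτ₀H : τ₀ ∉ H := fun h ↦ hτ₀ (hHmem.1 h)
    -- off `H`, the image of `v` lies on `E w₀`
    have hoff : ∀ τ, τ ∉ H → ∃ c : E, ((r τ : GL (Fin 2) E) : Matrix (Fin 2) (Fin 2) E) *ᵥ v = c • w₀ := by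
      intro τ hτ
      -- `r(τ) v` is an eigenvector of `r(σ₁)` (normality), hence on one of the two lines
      have hconj : τ⁻¹ * σ₁ * τ⁻¹⁻¹ ∈ V := hVn.conj_mem σ₁ hσ₁ τ⁻¹
      rw [inv_inv] at hconj
      have heig : ((r σ₁ : GL (Fin 2) E) : Matrix (Fin 2) (Fin 2) E) *ᵥ
          ((((r τ : GL (Fin 2) E) : Matrix (Fin 2) (Fin 2) E)) *ᵥ v) =
          χ₁ _ hconj • ((((r τ : GL (Fin 2) E) : Matrix (Fin 2) (Fin 2) E)) *ᵥ v) := by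
        calc ((r σ₁ : GL (Fin 2) E) : Matrix (Fin 2) (Fin 2) E) *ᵥ ((((r τ : GL (Fin 2) E) : Matrix (Fin 2) (Fin 2) E)) *ᵥ v)
            = ((r (σ₁ * τ) : GL (Fin 2) E) : Matrix (Fin 2) (Fin 2) E) *ᵥ v := by rw [← hact]
          _ = ((r (τ * (τ⁻¹ * σ₁ * τ)) : GL (Fin 2) E) : Matrix (Fin 2) (Fin 2) E) *ᵥ v := by
              rw [show σ₁ * τ = τ * (τ⁻¹ * σ₁ * τ) by group]
          _ = χ₁ _ hconj • ((((r τ : GL (Fin 2) E) : Matrix (Fin 2) (Fin 2) E)) *ᵥ v) := by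
              rw [hact, hχ₁ _ hconj, Matrix.mulVec_smul]
      rcases mem_lines_of_eigenvector hP hne (hχ₁ σ₁ hσ₁) (hχ₂ σ₁ hσ₁) heig with ⟨c, hc⟩ | ⟨c, hc⟩
      · exact absurd (hHmem.2 ⟨c, hc⟩) hτ
      · exact ⟨c, hc⟩
    -- hence `τ ∉ H → τ * τ₀ ∈ H`
    have hmulτ₀ : ∀ τ, τ ∉ H → τ * τ₀ ∈ H := by
      intro τ hτ
      have hτ' : τ⁻¹ ∉ H := fun h ↦ hτ (by simpa using H.inv_mem h)
      obtain ⟨c, hc⟩ := hoff _ hτ'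
      -- `r(τ⁻¹) v = c w₀ = c r(τ₀) v`, so `r(τ₀⁻¹ τ⁻¹) v ∈ E v`
      have hmem : τ₀⁻¹ * τ⁻¹ ∈ H := by
        refine hHmem.2 ⟨c, ?_⟩
        rw [hact, hc, Matrix.mulVec_smul, hw₀, hinv]
      have := H.inv_mem hmem
      rwa [_root_.mul_inv_rev, inv_inv, inv_inv] at this
    refine ⟨H, hVH, ?_, fun τ hτ ↦ ?_⟩
    · rw [Subgroup.index_eq_two_iff]
      refine ⟨τ₀, fun b ↦ ?_⟩
      by_cases hb : b ∈ H
      · refine Or.inr ⟨hb, fun hbτ ↦ ?_⟩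
        exact hτ₀H (by simpa using H.mul_mem (H.inv_mem hb) hbτ)
      · exact Or.inl ⟨hmulτ₀ b hb, hb⟩
    · obtain ⟨b, hb⟩ := hoff τ hτ
      -- `r(τ) w₀ = r(τ τ₀) v ∈ E v`
      obtain ⟨c, hc⟩ := hHmem.1 (hmulτ₀ τ hτ)
      refine trace_eq_zero_of_swap hP hb (c := c) ?_
      rw [hw₀, ← hact, hc]

end OpenImage

end Literature.NumberTheory.EllipticCurves.ModularForms
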